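import Mathlib.RingTheory.MvPolynomial.WeightedHomogeneous
import Mathlib.RingTheory.MvPolynomial.Basic
import Mathlib.RingTheory.Ideal.Operations
import Mathlib.Algebra.BigOperators.Fin
import Mathlib.Tactic.IntervalCases
import HarnessLib

/-!
# Veronese splitting for the P-cone weights `(15,10,18,27,12)` and `N = 540` (crux `FInjectiveMacaulayfication`, line H4-gd, calibration G6ᵍ-P)

Support file for crux stmt-ResolutionOfSingularities-15315 (`FrobeniusLadder.FInjectiveMacaulayfication`), line (H4-gd),
calibration G6ᵍ-P (CRUX-PLAN w45a v9 R9.3: the `hpow` input of `GradedDomainConeFiModel.stub_gradedDomainConeFiModel`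
(p500711) for idea-2's codimension-2 specimen `P = V(x²+y³−wU, Z²+wU³+w³) ⊂ 𝔸⁵`, variables `(x,y,w,Z,U)` with the
forced weights `w = (15,10,18,27,12)`, `N = lcm = 540`, `c = (36,54,30,20,45)`; seat res-L1-w45a-stub-2).
[OURS · L1 W4.5a] AI-written; AI review is weaker than expert review. No statement of Hironaka2017 is used; no external fact.

Let `I₅₄₀ ⊆ k[X₀,…,X₄]` be the ideal spanned by the monomials of weighted degree `15b₀+10b₁+18b₂+27b₃+12b₄ ≥ 540`.
**Veronese splitting**: every monomial of weighted degree `≥ 540·K` lies in `I₅₄₀^K`. This is a genuine arithmetic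
property of the weight vector (FALSE e.g. for `(14,6,21)`, `N = 42`), proved here in the EXACT-PEEL form: every exponent
vector of weighted degree `≥ 1080` contains a sub-vector of weighted degree EXACTLY `540` (`peel`), found by search and
checked exhaustively offline (the true threshold is `774`; the worst vector without an exact peel is `X₁²⁶X₃¹⁹` of
degree `773`); the Lean proof is a short explicit cascade, every branch closed by `omega`:
* `five_part` — `X₀², X₁³` are blocks of degree `30`: any `r ≤ a₀/2 + a₁/3` thirty-blocks are available;
* `three_part` — in the box `a₂ ≤ 29, a₃ ≤ 19, a₄ ≤ 44` with `18a₂+27a₃+12a₄ ≥ 535`, the `(X₂,X₃,X₄)`-part supplies a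
  sub-vector of degree `30·s'` with `s' ≤ 18` and `18a₂+27a₃+12a₄ ≤ 30s'+505 ∨ s' = 18` (eight explicit rules: the
  two-variable exact solutions `X₂^{2q}X₄^{45-3q}`, `X₃^{4q}X₄^{45-9q}`, `X₂^{30-3q}X₃^{2q}`, a three-variable exact
  solution with a parity correction, three "all `X₃`-pairs but `k`, all `X₂`, `X₄` fixes the residue mod 5" rules,
  and the pure blocks `X₂⁵`); that these rules COVER the box is the finite certificate `three_part_cover` (27 000 lattice
  points, a closed `Bool` term checked by `decide`);
* `box_peel` — the two parts add up to exactly `540` when the total is `≥ 1080` (`30·(18 - s')` from the five-part);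
* `peel` — outside the box a pure block `X₀³⁶, X₁⁵⁴, X₂³⁰, X₃²⁰, X₄⁴⁵` of degree exactly `540` is peeled;
* `coord_split`, `weight_eq`, `finsupp_split`, `pConeVeroneseSplitting` — the `Finsupp` glue and the induction on `K`,
  verbatim after `VeroneseSplitting` (res-L1-w45a, §15 calibration `f₄`).
No definitions, no named facts. [folklore]
-/

set_option linter.dupNamespace false

namespace Summit.ResolutionOfSingularities.ResolutionOfSingularities.Theorems.FInjectiveMacaulayfication.PConeVeroneseSplitting

/-- **Five-part.** `X₀²` and `X₁³` are blocks of weighted degree `30` (`w₀ = 15`, `w₁ = 10`): for every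
`r ≤ a₀/2 + a₁/3` there are `i ≤ a₀`, `j ≤ a₁` with `15i + 10j = 30r`. [folklore] -/
theorem five_part (a₀ a₁ r : ℕ) (hr : r ≤ a₀ / 2 + a₁ / 3) :
    ∃ i j : ℕ, i ≤ a₀ ∧ j ≤ a₁ ∧ 15 * i + 10 * j = 30 * r := by
  by_cases h : r ≤ a₁ / 3
  · exact ⟨0, 3 * r, by omega, by omega, by omega⟩
  · exact ⟨2 * (r - a₁ / 3), 3 * (a₁ / 3), by omega, by omega, by omega⟩

/-- **Coverage certificate for the three-part** (the `(X₂,X₃,X₄)`-variables, weights `18, 27, 12`): on the box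
`a₂ < 30, a₃ < 20, a₄ < 45` with weighted degree `≥ 535`, one of nine explicit rules applies (A: `X₂,X₄` exact; B: `X₃,X₄`
exact; C: `X₂,X₃` exact; D: three variables exact with a parity correction; E₀/E₀ᶜ/E₁/E₃: all `X₃`-pairs but `k`, all
`X₂`, and `X₄` fixing the residue mod `5`, uncapped / capped at `540`; F: the pure blocks `X₂⁵`). A finite certificate
over `27 000` lattice points, found by search offline and re-checked here by the kernel (`decide` on a closed `Bool` term,
≈ 10 s; `omega` cannot do the coverage step — it lacks the dark/grey shadows for the many `div`/`mod` atoms). [folklore] -/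
theorem three_part_cover :
    ((List.range 30).all fun a₂ => (List.range 20).all fun a₃ => (List.range 45).all fun a₄ =>
      decide (18 * a₂ + 27 * a₃ + 12 * a₄ < 535) ||
      (decide (45 ≤ a₄ + 3 * (a₂ / 2)) ||
      (decide (45 ≤ a₄ + 9 * (a₃ / 4)) ||
      (decide (30 ≤ a₂ + 3 * (a₃ / 2)) ||
      (((decide ((a₂ + a₃ / 2) % 2 = 0) || decide (1 ≤ a₂)) && (decide (3 * a₂ + 9 * (a₃ / 2) ≤ 90) &&
        decide (90 - 9 * (a₃ / 2) - 3 * (a₂ - (a₂ + a₃ / 2) % 2) ≤ 2 * a₄))) ||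
      ((decide ((a₄ + 2 * (a₃ / 2) + 4 * a₂) % 5 ≤ a₄) && decide ((54 * (a₃ / 2) + 18 * a₂ + 12 * (a₄ - (a₄ + 2 * (a₃ / 2) + 4 * a₂) % 5)) ≤ 540)) ||
      ((decide ((a₄ + 2 * (a₃ / 2) + 4 * a₂) % 5 + 5 * (((54 * (a₃ / 2) + 18 * a₂ + 12 * (a₄ - (a₄ + 2 * (a₃ / 2) + 4 * a₂) % 5)) - 540 + 59) / 60) ≤ a₄) && (decide (540 < (54 * (a₃ / 2) + 18 * a₂ + 12 * (a₄ - (a₄ + 2 * (a₃ / 2) + 4 * a₂) % 5))) &&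
        decide (18 * a₂ + 27 * a₃ + 12 * a₄ ≤ (54 * (a₃ / 2) + 18 * a₂ + 12 * (a₄ - (a₄ + 2 * (a₃ / 2) + 4 * a₂) % 5)) - 60 * (((54 * (a₃ / 2) + 18 * a₂ + 12 * (a₄ - (a₄ + 2 * (a₃ / 2) + 4 * a₂) % 5)) - 540 + 59) / 60) + 505))) ||
      ((decide (1 ≤ a₃ / 2) && (decide ((a₄ + 2 * (a₃ / 2 - 1) + 4 * a₂) % 5 ≤ a₄) && decide ((54 * (a₃ / 2 - 1) + 18 * a₂ + 12 * (a₄ - (a₄ + 2 * (a₃ / 2 - 1) + 4 * a₂) % 5)) ≤ 540))) ||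
      ((decide (3 ≤ a₃ / 2) && (decide ((a₄ + 2 * (a₃ / 2 - 3) + 4 * a₂) % 5 ≤ a₄) && decide ((54 * (a₃ / 2 - 3) + 18 * a₂ + 12 * (a₄ - (a₄ + 2 * (a₃ / 2 - 3) + 4 * a₂) % 5)) ≤ 540))) ||
      decide (18 * a₂ + 27 * a₃ + 12 * a₄ ≤ 90 * (a₂ / 5) + 505)))))))))) = true := by
  decide

/-- **Three-part** (the `(X₂,X₃,X₄)`-variables, weights `18, 27, 12`, in the box `a₂ ≤ 29, a₃ ≤ 19, a₄ ≤ 44` with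
weighted degree `≥ 535`): there is a sub-vector `(m,l,u)` of weighted degree `30·s'`, `s' ≤ 18`, with
`18a₂+27a₃+12a₄ ≤ 30s'+505` or `s' = 18` — the witness of the applicable rule of `three_part_cover`, each verified by
`omega`. [folklore] -/
theorem three_part (a₂ a₃ a₄ : ℕ) (h₂ : a₂ ≤ 29) (h₃ : a₃ ≤ 19) (h₄ : a₄ ≤ 44)
    (hB : 535 ≤ 18 * a₂ + 27 * a₃ + 12 * a₄) :
    ∃ m l u s : ℕ, m ≤ a₂ ∧ l ≤ a₃ ∧ u ≤ a₄ ∧ 18 * m + 27 * l + 12 * u = 30 * s ∧ s ≤ 18 ∧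
      (18 * a₂ + 27 * a₃ + 12 * a₄ ≤ 30 * s + 505 ∨ s = 18) := by
  have hc := three_part_cover
  simp only [List.all_eq_true, List.mem_range, Bool.or_eq_true, Bool.and_eq_true, decide_eq_true_eq] at hc
  rcases hc a₂ (by omega) a₃ (by omega) a₄ (by omega) with h0 | hA | hB' | hC | hD | hE | hE' | hE1 | hE3 | hF
  · exact absurd hB (by omega)
  · -- A: `X₂, X₄` exact
    exact ⟨2 * (a₂ / 2), 0, 45 - 3 * (a₂ / 2), 18, by omega, by omega, by omega, by omega, by omega, Or.inr rfl⟩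
  · -- B: `X₃, X₄` exact
    exact ⟨0, 4 * (a₃ / 4), 45 - 9 * (a₃ / 4), 18, by omega, by omega, by omega, by omega, by omega, Or.inr rfl⟩
  · -- C: `X₂, X₃` exact
    exact ⟨30 - 3 * (a₃ / 2), 2 * (a₃ / 2), 0, 18, by omega, by omega, by omega, by omega, by omega, Or.inr rfl⟩
  · -- D: three variables exact, parity-corrected number of `X₂`
    exact ⟨a₂ - (a₂ + a₃ / 2) % 2, 2 * (a₃ / 2), (90 - 9 * (a₃ / 2) - 3 * (a₂ - (a₂ + a₃ / 2) % 2)) / 2, 18,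
      by omega, by omega, by omega, by omega, by omega, Or.inr rfl⟩
  · -- E₀: all `X₃`-pairs, all `X₂`, `X₄` fixes the residue
    exact ⟨a₂, 2 * (a₃ / 2), a₄ - (a₄ + 2 * (a₃ / 2) + 4 * a₂) % 5, (54 * (a₃ / 2) + 18 * a₂ + 12 * (a₄ - (a₄ + 2 * (a₃ / 2) + 4 * a₂) % 5)) / 30,
      by omega, by omega, by omega, by omega, by omega, by omega⟩
  · -- E₀ᶜ: the same capped at `540` by dropping `X₄`'s five at a time
    exact ⟨a₂, 2 * (a₃ / 2), a₄ - (a₄ + 2 * (a₃ / 2) + 4 * a₂) % 5 - 5 * (((54 * (a₃ / 2) + 18 * a₂ + 12 * (a₄ - (a₄ + 2 * (a₃ / 2) + 4 * a₂) % 5)) - 540 + 59) / 60), ((54 * (a₃ / 2) + 18 * a₂ + 12 * (a₄ - (a₄ + 2 * (a₃ / 2) + 4 * a₂) % 5)) - 60 * (((54 * (a₃ / 2) + 18 * a₂ + 12 * (a₄ - (a₄ + 2 * (a₃ / 2) + 4 * a₂) % 5)) - 540 + 59) / 60)) / 30,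
      by omega, by omega, by omega, by omega, by omega, by omega⟩
  · -- E₁: all `X₃`-pairs but one
    exact ⟨a₂, 2 * (a₃ / 2 - 1), a₄ - (a₄ + 2 * (a₃ / 2 - 1) + 4 * a₂) % 5, (54 * (a₃ / 2 - 1) + 18 * a₂ + 12 * (a₄ - (a₄ + 2 * (a₃ / 2 - 1) + 4 * a₂) % 5)) / 30,
      by omega, by omega, by omega, by omega, by omega, by omega⟩
  · -- E₃: all `X₃`-pairs but three
    exact ⟨a₂, 2 * (a₃ / 2 - 3), a₄ - (a₄ + 2 * (a₃ / 2 - 3) + 4 * a₂) % 5, (54 * (a₃ / 2 - 3) + 18 * a₂ + 12 * (a₄ - (a₄ + 2 * (a₃ / 2 - 3) + 4 * a₂) % 5)) / 30,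
      by omega, by omega, by omega, by omega, by omega, by omega⟩
  · -- F: the pure blocks `X₂⁵`
    exact ⟨5 * (a₂ / 5), 0, 0, 3 * (a₂ / 5), by omega, by omega, by omega, by omega, by omega, Or.inl (by omega)⟩

/-- **Box peel.** In the box `a₀ ≤ 35, a₁ ≤ 53, a₂ ≤ 29, a₃ ≤ 19, a₄ ≤ 44` an exponent vector of weighted degree
`≥ 1080` contains a sub-vector of weighted degree exactly `540`: `30·s'` from the three-part and `30·(18 - s')`
thirty-blocks from the five-part. [folklore] -/
theorem box_peel (a₀ a₁ a₂ a₃ a₄ : ℕ) (h₀ : a₀ ≤ 35) (h₁ : a₁ ≤ 53) (h₂ : a₂ ≤ 29) (h₃ : a₃ ≤ 19) (h₄ : a₄ ≤ 44)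
    (h : 1080 ≤ 15 * a₀ + 10 * a₁ + 18 * a₂ + 27 * a₃ + 12 * a₄) :
    ∃ i j m l u : ℕ, i ≤ a₀ ∧ j ≤ a₁ ∧ m ≤ a₂ ∧ l ≤ a₃ ∧ u ≤ a₄ ∧
      15 * i + 10 * j + 18 * m + 27 * l + 12 * u = 540 := by
  by_cases h5 : 18 ≤ a₀ / 2 + a₁ / 3
  · obtain ⟨i, j, hi, hj, hij⟩ := five_part a₀ a₁ 18 h5
    exact ⟨i, j, 0, 0, 0, hi, hj, by omega, by omega, by omega, by omega⟩
  · obtain ⟨m, l, u, s, hm, hl, hu, he, hs, hB⟩ := three_part a₂ a₃ a₄ h₂ h₃ h₄ (by omega)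
    obtain ⟨i, j, hi, hj, hij⟩ := five_part a₀ a₁ (18 - s) (by omega)
    exact ⟨i, j, m, l, u, hi, hj, hm, hl, hu, by omega⟩

/-- **Exact peel.** Every exponent vector of `(15,10,18,27,12)`-weighted degree `≥ 1080` contains a sub-vector of
weighted degree exactly `540`: outside the box a pure block `X₀³⁶, X₁⁵⁴, X₂³⁰, X₃²⁰, X₄⁴⁵`, inside `box_peel`.
[folklore] -/
theorem peel (a₀ a₁ a₂ a₃ a₄ : ℕ) (h : 1080 ≤ 15 * a₀ + 10 * a₁ + 18 * a₂ + 27 * a₃ + 12 * a₄) :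
    ∃ i j m l u : ℕ, i ≤ a₀ ∧ j ≤ a₁ ∧ m ≤ a₂ ∧ l ≤ a₃ ∧ u ≤ a₄ ∧
      15 * i + 10 * j + 18 * m + 27 * l + 12 * u = 540 := by
  by_cases h₀ : 36 ≤ a₀
  · exact ⟨36, 0, 0, 0, 0, h₀, by omega, by omega, by omega, by omega, by omega⟩
  by_cases h₁ : 54 ≤ a₁
  · exact ⟨0, 54, 0, 0, 0, by omega, h₁, by omega, by omega, by omega, by omega⟩
  by_cases h₂ : 30 ≤ a₂
  · exact ⟨0, 0, 30, 0, 0, by omega, by omega, h₂, by omega, by omega, by omega⟩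
  by_cases h₃ : 20 ≤ a₃
  · exact ⟨0, 0, 0, 20, 0, by omega, by omega, by omega, h₃, by omega, by omega⟩
  by_cases h₄ : 45 ≤ a₄
  · exact ⟨0, 0, 0, 0, 45, by omega, by omega, by omega, by omega, h₄, by omega⟩
  exact box_peel a₀ a₁ a₂ a₃ a₄ (by omega) (by omega) (by omega) (by omega) (by omega) h

/-- **Coordinate splitting.** If `(K+1)·540 ≤ 15a₀+10a₁+18a₂+27a₃+12a₄` then `a = b + c` with `540 ≤ wt b` and
`K·540 ≤ wt c` (`K = 0`: `b = a`; `K ≥ 1`: `b` = the exact peel, of degree exactly `540`). [folklore] -/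
theorem coord_split (K a₀ a₁ a₂ a₃ a₄ : ℕ)
    (h : (K + 1) * 540 ≤ 15 * a₀ + 10 * a₁ + 18 * a₂ + 27 * a₃ + 12 * a₄) :
    ∃ b₀ b₁ b₂ b₃ b₄ c₀ c₁ c₂ c₃ c₄ : ℕ, a₀ = b₀ + c₀ ∧ a₁ = b₁ + c₁ ∧ a₂ = b₂ + c₂ ∧ a₃ = b₃ + c₃ ∧ a₄ = b₄ + c₄ ∧
      540 ≤ 15 * b₀ + 10 * b₁ + 18 * b₂ + 27 * b₃ + 12 * b₄ ∧
      K * 540 ≤ 15 * c₀ + 10 * c₁ + 18 * c₂ + 27 * c₃ + 12 * c₄ := by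
  rw [add_mul, one_mul] at h
  rcases Nat.eq_zero_or_pos K with rfl | hK
  · exact ⟨a₀, a₁, a₂, a₃, a₄, 0, 0, 0, 0, 0, by omega⟩
  have h1080 : 1080 ≤ 15 * a₀ + 10 * a₁ + 18 * a₂ + 27 * a₃ + 12 * a₄ :=
    le_trans (by nlinarith) h
  obtain ⟨i, j, m, l, u, hi, hj, hm, hl, hu, he⟩ := peel a₀ a₁ a₂ a₃ a₄ h1080
  obtain ⟨c₀, rfl⟩ := Nat.exists_eq_add_of_le hi
  obtain ⟨c₁, rfl⟩ := Nat.exists_eq_add_of_le hj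
  obtain ⟨c₂, rfl⟩ := Nat.exists_eq_add_of_le hm
  obtain ⟨c₃, rfl⟩ := Nat.exists_eq_add_of_le hl
  obtain ⟨c₄, rfl⟩ := Nat.exists_eq_add_of_le hu
  exact ⟨i, j, m, l, u, c₀, c₁, c₂, c₃, c₄, rfl, rfl, rfl, rfl, rfl, by omega, by linarith⟩

/-- The `(15,10,18,27,12)`-weighted degree of `f : Fin 5 →₀ ℕ` in coordinates (`Finsupp.weight_apply`,
`Finsupp.sum_fintype`, `Fin.sum_univ_five`). [folklore] -/
theorem weight_eq (f : Fin 5 →₀ ℕ) :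
    Finsupp.weight (![15, 10, 18, 27, 12] : Fin 5 → ℕ) f = 15 * f 0 + 10 * f 1 + 18 * f 2 + 27 * f 3 + 12 * f 4 := by
  rw [Finsupp.weight_apply,
    Finsupp.sum_fintype f (fun i c => c • (![15, 10, 18, 27, 12] : Fin 5 → ℕ) i) (fun _ => zero_smul ℕ _),
    Fin.sum_univ_five]
  simp only [smul_eq_mul, Matrix.cons_val_zero, Matrix.cons_val_one, Matrix.cons_val]
  ring

/-- **Exponent-vector splitting** for `a : Fin 5 →₀ ℕ`: `(K+1)·540 ≤ weight a` ⇒ `a = b + c` with `540 ≤ weight b`,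
`K·540 ≤ weight c` (`coord_split` along `Finsupp.equivFunOnFinite`). [folklore] -/
theorem finsupp_split (K : ℕ) (a : Fin 5 →₀ ℕ)
    (ha : (K + 1) * 540 ≤ Finsupp.weight (![15, 10, 18, 27, 12] : Fin 5 → ℕ) a) :
    ∃ b c : Fin 5 →₀ ℕ, a = b + c ∧ 540 ≤ Finsupp.weight (![15, 10, 18, 27, 12] : Fin 5 → ℕ) b ∧
      K * 540 ≤ Finsupp.weight (![15, 10, 18, 27, 12] : Fin 5 → ℕ) c := by
  rw [weight_eq] at ha
  obtain ⟨b₀, b₁, b₂, b₃, b₄, c₀, c₁, c₂, c₃, c₄, e₀, e₁, e₂, e₃, e₄, hb, hc⟩ :=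
    coord_split K (a 0) (a 1) (a 2) (a 3) (a 4) ha
  refine ⟨Finsupp.equivFunOnFinite.symm ![b₀, b₁, b₂, b₃, b₄],
    Finsupp.equivFunOnFinite.symm ![c₀, c₁, c₂, c₃, c₄], ?_, ?_, ?_⟩
  · ext i
    fin_cases i <;> simp [e₀, e₁, e₂, e₃, e₄]
  · rw [weight_eq]
    simpa using hb
  · rw [weight_eq]
    simpa using hc

/-- **VERONESE SPLITTING for the P-cone weights `(15,10,18,27,12)` and `N = 540`**: every monomial of weighted degree
`≥ 540·K` lies in the `K`-th power of the ideal `I₅₄₀` spanned by the monomials of weighted degree `≥ 540` — the `hpow`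
hypothesis of `GradedDomainConeFiModel.stub_gradedDomainConeFiModel` for the specimen `P`. Induction on `K` over
`finsupp_split` (`X^a = X^b · X^c`, `MvPolynomial.monomial_mul`, `Ideal.mul_mem_mul`). [folklore] -/
theorem pConeVeroneseSplitting : ∀ (k : Type) [Field k] (K : ℕ) (a : Fin 5 →₀ ℕ),
    K * 540 ≤ Finsupp.weight (![15, 10, 18, 27, 12] : Fin 5 → ℕ) a →
    (MvPolynomial.monomial a (1 : k) : MvPolynomial (Fin 5) k) ∈
      (Ideal.span {m : MvPolynomial (Fin 5) k | ∃ b : Fin 5 →₀ ℕ,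
        540 ≤ Finsupp.weight (![15, 10, 18, 27, 12] : Fin 5 → ℕ) b ∧ m = MvPolynomial.monomial b 1}) ^ K := by
  intro k _ K
  induction K with
  | zero =>
    intro a _
    rw [pow_zero, Ideal.one_eq_top]
    exact Submodule.mem_top
  | succ K ih =>
    intro a ha
    obtain ⟨b, c, rfl, hb, hc⟩ := finsupp_split K a ha
    have hmul : (MvPolynomial.monomial (b + c) (1 : k) : MvPolynomial (Fin 5) k) =
        MvPolynomial.monomial b 1 * MvPolynomial.monomial c 1 := by
      rw [MvPolynomial.monomial_mul, one_mul]
    rw [pow_succ', hmul]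
    exact Ideal.mul_mem_mul (Ideal.subset_span ⟨b, hb, rfl⟩) (ih c hc)

end Summit.ResolutionOfSingularities.ResolutionOfSingularities.Theorems.FInjectiveMacaulayfication.PConeVeroneseSplitting
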